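import Summits.BirchSwinnertonDyer.Rank1Residual.Additive.X4RankZeroLowerKolyvaginIndexForm
import Summits.BirchSwinnertonDyer.Rank1Residual.GaloisImage.ThreeAdicTowerRecordsKolyS0KD3
import Summits.BirchSwinnertonDyer.Rank1Residual.X9.ChaDescentRecords
import Summits.BirchSwinnertonDyer.Rank1Residual.X11b.ChaPairsMinimality
import Summits.BirchSwinnertonDyer.BirchSwinnertonDyer.Theorems.Rank1ResidualX11RankOneMinimality
import Summits.BirchSwinnertonDyer.BirchSwinnertonDyer.Theorems.Rank1ResidualIntModelReduction
import Literature.NumberTheory.EllipticCurves.HeegnerHypothesisKroneckerProofs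
import Literature.NumberTheory.EllipticCurves.IsogenyHasCMIffJMemProofs
import Mathlib.Tactic.NormNum.LegendreSymbol
import HarnessLib

/-!
# B-18 `KOLY-DERIV1@3` certificate RECORD no. 1 — `2601h1` (`N = 3²·17²`, `p = 3`, `r_an = 0`,
# `#Ш_an = 9`): `#Ш(E/ℚ)[3^∞] = 9` and `BSD(E,3)` from ONE Kolyvagin DERIVED-point certificate, the
# first such certificate at a prime `p` with `p² ∣ N` computed in this cell (team n1011, seat p10 gen 2)

HONEST FRAMING (cell `b2b-bsdres`, run/shared/lean/b2b/bsd-rank1-residual/, verbatim in every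
file): the goal of the cell is to DELETE the COMBINATION-SHAPED residual classes of the
Birch–Swinnerton-Dyer formula for ALL analytic-rank `≤ 1` elliptic curves over `ℚ` — "full BSD
formula for every rank `≤ 1` curve in class `C`" assembled STRICTLY from published theorems — so
that the rank-`≤ 1` remainder becomes exactly the CONSTRUCTION-SHAPED classes, which are TYPED
(missing-input `Prop`s), NOT attempted. This is not "finishing BSD". Team n1011 (N10/N11: X4 ∧
`p = 3`), seat p10: research route on the CONSTRUCTION-SHAPED class X4; prove what is provable now;
no claim beyond stated classes; census output = EVIDENCE / conjecture items, never a Literature fact;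
the label X4 is UNCHANGED; nothing is booked by this file. A PER-PAIR record (a certificate shape),
not a class theorem. Theorems only (no definition, no named fact; the two named facts enter as the
hypotheses `h₁`, `h₂`).

## What this file does

cc-eng-5's pre-registered S0-KD-3 batch 1 (`class-closure/eng-5/koly/step0/S0-KD-PREREG.md`, sha16
c0b9a63f) ran the lane's derived-point engine on six sha-2 V12-CLOSED X4@3 rows; ONE row is inside
route A's reach and FIRED: `2601h1` (the other five — `19107f1`, `6165g1`, `5499e1`, `6867e1`,
`15426e1` — are "out of route-A reach" as filed; their record shapes stay in this seat's drafts).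
CERTIFICATE OF RECORD (cc-eng-5, B-18 route A, engine E1 `kolyderiv.gp` v0.4/v0.4.1, PARI 2.17.2;
`class-closure/eng-5/koly/step0/S0-KD3-REPORT.md` sha16 2bec32d701b3ca98; runs `koly/runs/S0-KD-3_2601h1_E1v04_j123743.*`,
`…_E1v041_j123905.*`, product cross-check `…_E1v042_product_j124104`): `K = ℚ(√−8)` (`d_K = −8`, `h_K = 1`),
Kolyvagin prime `ℓ = 5` (`a₅ = 0`, `3 ∣ 6`, `(−8/5) = −1`; `d = [K[5]:K] = 6`), `y₅` EXACTLY on `E` over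
`L = K(θ)`, `θ⁶ − 2θ⁵ − 2θ − 1`, automorphism labelling a bijection, trace identity `Tr y₅ = a₅·y₁ = O`
PASS, and the DECISION **`P₅ ∉ 3·E(K[5])`** — T1 exact (`A₃ − x(P₅)B₃` has no root in `L`, `nfroots`) +
T2 reduction witness `v = 59` (`#Ẽ(𝔽₅₉) = 72`, `P̄₅ ∉ 3Ẽ(𝔽_v)`); 2 400 digits, 119 s. The INDEX half
`ord₃ [E(K):ℤy_K] = 1` (`M₀ = 1`): sha-2 koly3 (two engines) and additive-p1's kernel-rechecked table
`AdditivePotMult.HeegnerIndexRecords.checked_x4_three_rankZero_heegnerIndex` (row `2601h1`, `D = −8`,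
`m₁ = m₂ = 12`, `ord₃ = 1`). LABEL: **SINGLE-ENGINE, pre-countersign** (E2 `kolyderiv2.py` product run
j124105 in progress; census-lead G-4 / referee-2 countersign / cc-lead AK2 ruling pending) — EVIDENCE;
the row is a sha-2 V12-CLOSED calibration row (P18 consistency PASS: the fired certificate says
`M₁ = 0`, i.e. `#Ш(E)[3^∞] = 3^{2(M₀−M₁)} = 9`, exactly V12's `(ℤ/3)²`); nothing new is closed and
nothing is booked by this record.

THE RECORD (`card_sha3_v2601h1`, `bsdp3_v2601h1`): for any `W` equal to Cremona's minimal model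
`[1, −1, 0, −59877, −3934008]`, GIVEN the two primary facts (`h₁` McCallum 1991 §1 Theorem + Thm. 5.4,
`h₂` Matar–Nekovář 2019 Thm. 0.7/§0.11 — consumer
`Additive.card_sha_primary_eq_of_indexCertificate_of_matarNekovar`, p252487), the table binders
`N = 2601` (`hN`), `r_an = 0` (`hr`), `#Ш_an = 9` (`hq`), the Heegner field through its discriminant
(`hdK : d_K = −8` for an abstract `K`, imaginary quadratic `hK`; `5` inert in `K` as `hinert` —
`(−8/5) = −1`; no tree lemma derives inertness from the Kronecker symbol yet), and the CERTIFICATE as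
hypotheses — Heegner data `d₁`, `d` of conductor `1` and `5` for a parametrisation datum of level `N`,
`y_K = P` of infinite order and finite index with `ord₃ [E(K):ℤP] = 1` (`hy`, `hidx`, `hv`), and
`P₅ ∉ 3·E(K[5])` (`hPℓ`) — the kernel concludes `#Ш(E/ℚ)[3^∞] = 3²` and `BSD(E,3)`. IN THE KERNEL:
`Δ ≠ 0`; global minimality of Cremona's model (bounded Kraus criterion, `decide`); non-CM (`j ∉` the
thirteen CM values, `hasCM_iff_j_mem_holds`); the `3`-ADIC TOWER `∀ n, ρ̄_{E,3ⁿ}` onto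
(`GaloisImage.towerSurj3_v2601h1`, this seat's `ThreeAdicTowerRecordsKolyS0KD3`: witnesses `ℓ₁ = 11`,
`ℓ₂ = 13`, certificate `ℓ₃ = 59` — McCallum's image binder, flag `McCallum91-padic-image` discharged);
the Heegner hypothesis for `(2601, −8)` (`(−8/3) = (−8/17) = 1`, `satisfiesHeegnerHypothesis_iff_kronecker`);
`d_K ∉ {−3, −4}`; and for `ℓ = 5`: prime, `5 ∤ 2601`, `5 ∤ −8`, `5 ≠ 3`, `M(5) ≥ 1` (`3 ∣ 6`;
`a₅ = 0` from the kernel point count `#Ẽ(𝔽₅) = 6`) — every conjunct of `Zhang2014.IsKolyvaginPrime`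
except inertness. Review flags carried (`X4RankZeroLowerKolyvaginIndexForm.lean` §4 module doc):
`McCallum91-eigenspace-dictionary`, `MN19-0.7-0.11-structure-composite`, `Kolyvagin1991-LNM1479-primary-unread`.

References: McCallum 1991 [McCallumLMS1991] §1, Lemma 5.1, Thm. 5.4, Cor. 5.5; Matar–Nekovář 2019
[MatarNekovar2019] Thm. 0.7, §0.11; Gross 1991 [GrossLMS1991] §3; W. Zhang 2014 [WZhang2014]
Notations (xii); Jetchev–Lauter–Stein 2007 (arXiv:0707.0032) §2 (the computation scheme); Silverman
AEC [SilvermanAEC2009] VII.1 Rem. 1.1, App. C §11; Miller 2011 [Miller2011LMS] Def. 1.1; Marcus,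
Number Fields [Marcus2018] Ch. 3 Thm. 25; Cremona's tables [Cremona2006] (`allcurves`, `allbsd`).
-/

set_option autoImplicit false

noncomputable section

open scoped Classical NumberField

open WeierstrassCurve Literature.NumberTheory.EllipticCurves
  Literature.NumberTheory.EllipticCurves.ModularForms
  Literature.NumberTheory.EllipticCurves.Rank1Residual
  Literature.NumberTheory.EllipticCurves.Rank1Residual.Typed
  Summit.BirchSwinnertonDyer.BirchSwinnertonDyer.Rank1Residual.IntModel
  Summit.BirchSwinnertonDyer.BirchSwinnertonDyer.Rank1Residual.X11RankOne
  Summit.BirchSwinnertonDyer.Rank1Residual.GaloisImage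

namespace Summit.BirchSwinnertonDyer.Rank1Residual.Additive.X4KolyvaginRecords

/-! ### §0 The Heegner hypothesis for `(N, d_K) = (2601, −8)` (Kronecker symbols) -/

/-- `2601 = 3²·17²`: its prime divisors. [folklore] -/
theorem prime_dvd_2601 {p : ℕ} (hp : p.Prime) (h : p ∣ 2601) : p = 3 ∨ p = 17 := by
  have h' : p ∣ 3 * (3 * (17 * 17)) := by norm_num at h ⊢; exact h
  rcases (Nat.Prime.dvd_mul hp).1 h' with hq | h'
  · have := (Nat.prime_dvd_prime_iff_eq hp (by norm_num : Nat.Prime 3)).1 hq; subst this; simp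
  rcases (Nat.Prime.dvd_mul hp).1 h' with hq | h'
  · have := (Nat.prime_dvd_prime_iff_eq hp (by norm_num : Nat.Prime 3)).1 hq; subst this; simp
  rcases (Nat.Prime.dvd_mul hp).1 h' with hq | h'
  · have := (Nat.prime_dvd_prime_iff_eq hp (by norm_num : Nat.Prime 17)).1 hq; subst this; simp
  · have := (Nat.prime_dvd_prime_iff_eq hp (by norm_num : Nat.Prime 17)).1 h'; subst this; simp

/-- **Heegner hypothesis for `(N, d_K) = (2601, -8)`**: `(-8/3) = 1`, `(-8/17) = 1`, so every prime of `N`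
splits in `K` (decomposition law, `satisfiesHeegnerHypothesis_iff_kronecker`). [folklore] -/
theorem heegner_2601_neg8 (K : Type) [Field K] [NumberField K] (h2 : Module.finrank ℚ K = 2)
    (hdK : NumberField.discr K = -8) : SatisfiesHeegnerHypothesis 2601 K := by
  rw [satisfiesHeegnerHypothesis_iff_kronecker 2601 K h2, hdK]
  intro p hp hpN
  rcases prime_dvd_2601 hp hpN with rfl | rfl
  · exact ⟨fun h ↦ absurd h (by norm_num), fun _ ↦ by norm_num⟩
  · exact ⟨fun h ↦ absurd h (by norm_num), fun _ ↦ by norm_num⟩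

/-! ### §1 `2601h1`: the Kolyvagin prime `ℓ = 5` (`a₅ = 0`) and the record -/

/-- `#Ẽ(𝔽_{5}) = 6` for Cremona's model `2601h1 = [1, -1, 0, -59877, -3934008]` (`a₅ = 0`; the record's Kolyvagin prime `ℓ = 5`). [folklore] -/
theorem card_v2601h1_5 :
    Nat.card (((⟨1, -1, 0, -59877, -3934008⟩ : WeierstrassCurve ℤ).map
      (Int.castRingHom (ZMod 5))).toAffine.Point) = 6 := by
  rw [@WeierstrassCurve.natCard_point_eq_one_add_card (ZMod 5) (@ZMod.instField 5 ⟨by norm_num⟩) _ _ _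
    (by decide +kernel), @card_sol_eq_sum_euler (ZMod 5) (@ZMod.instField 5 ⟨by norm_num⟩) _ _
    (by rw [ZMod.ringChar_zmod_n]; decide), ZMod.card]
  decide +kernel

/-- **RECORD `2601h1`: `#Ш(E/ℚ)[3^∞] = 3²` from ONE derived-point certificate** (`N = 2601 = 3²·17²`; Cremona's minimal model `[1, -1, 0, -59877, -3934008]`; ADDITIVE
(potentially multiplicative) at `3`; `r_an = 0`, `#Ш_an = 9`, `ρ̄_{E,3}` onto — sha-2 V12-CLOSED row;
S0-KD-3 batch 1, Heegner field `K = ℚ(√−8)`; certificate of record: `ℓ = 5`, `P₅ ∉ 3·E(K[5])` — T1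
exact + T2 witness `v = 59`; E1 v0.4.1 j123905 (+ j123743, product cross-check j124104), 2 400 digits;
index half `ord₃ [E(K):ℤy_K] = 1` two-engine (sha-2 koly3; additive-p1 kernel table row `2601h1`);
LABEL SINGLE-ENGINE pre-countersign — EVIDENCE, nothing booked).
Binders: the two primary facts `h₁`, `h₂`; table values `hN`, `hr`; the field by `hdK` (+ `hinert`);
the certificate (`d₁`, `P`, `hP`, `hy`, `hidx`, `hv`; `d`, `hPℓ`). IN THE KERNEL: `Δ ≠ 0`, minimality,
non-CM, the `3`-adic tower (`GaloisImage.towerSurj3_v2601h1`), the Heegner hypothesis,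
`d_K ∉ {−3, −4}`, and `ℓ` prime with `ℓ ∤ N·d_K·3`, `M(ℓ) ≥ 1`.
[cite: McCallumLMS1991, §1 Theorem (Kolyvagin) (p. 296), Thm. 5.4 (p. 308)]
[cite: MatarNekovar2019, Thm. 0.7 and §0.11 (pp. 456–457)] [cite: WZhang2014, Notations (xii)]
[cite: SilvermanAEC2009, VII.1 Remark 1.1 and App. C §11] -/
theorem card_sha3_v2601h1
    (h₁ : McCallum1991_card_sha_primary_of_derivedPoint_not_divisible)
    (h₂ : MatarNekovar2019_card_sha_primary_baseChange_of_derivedPoint_not_divisible_of_irreducible)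
    (W : WeierstrassCurve ℚ) (hW : W = ⟨1, -1, 0, -59877, -3934008⟩) [NeZero (W.conductorNorm ℤ)]
    (hN : W.conductorNorm ℤ = 2601) (hr : W.analyticRank = 0)
    {K : Type} [Field K] [NumberField K] (hK : IsImaginaryQuadratic K)
    (hdK : NumberField.discr K = -8) (hinert : (Ideal.span {((5 : ℕ) : 𝓞 K)}).IsPrime)
    {Dt : ModularParametrizationData W (W.conductorNorm ℤ)} {β : ℤ} {ι : K →+* ℂ}
    (d₁ : KolyvaginHeegnerData Dt β ι 1) (P : (W.baseChange K).toAffine.Point)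
    (hP : d₁.toGeomPoints d₁.derivedPoint = WeierstrassCurve.toGeomPoints (W.baseChange K) P)
    (hy : ¬ IsOfFinAddOrder P) (hidx : (AddSubgroup.zmultiples P).index ≠ 0)
    (hv : padicValNat 3 (AddSubgroup.zmultiples P).index = 1)
    (d : KolyvaginHeegnerData Dt β ι 5)
    (hPℓ : ¬ ∃ Q : (W.baseChange (ringClassField K ι 5)).toAffine.Point,
      ((3 : ℕ) : ℤ) • Q = d.derivedPoint) :
    haveI : Fact (Nat.Prime 3) := ⟨Nat.prime_three⟩
    Nat.card (AddCommGroup.primaryComponent W.sha 3) = 3 ^ (2 * 1) := by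
  haveI : Fact (Nat.Prime 3) := ⟨Nat.prime_three⟩
  subst hW
  haveI hE : (⟨1, -1, 0, -59877, -3934008⟩ : WeierstrassCurve ℚ).IsElliptic :=
    X11b.isElliptic_of_discOf_ne_zero 1 (-1) 0 (-59877) (-3934008) (by decide +kernel)
  haveI hM : (⟨1, -1, 0, -59877, -3934008⟩ : WeierstrassCurve ℚ).IsGloballyMinimal :=
    isGloballyMinimal_of_krausCriterion_bounded 1 (-1) 0 (-59877) (-3934008)
      (by decide +kernel) (by decide +kernel) (by decide +kernel)
  have hI : integralModelInt (⟨1, -1, 0, -59877, -3934008⟩ : WeierstrassCurve ℚ) =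
      (⟨1, -1, 0, -59877, -3934008⟩ : WeierstrassCurve ℤ) :=
    integralModelInt_eq_of_map_eq _ (map_mk_int 1 (-1) 0 (-59877) (-3934008))
  have hCM : ¬ (⟨1, -1, 0, -59877, -3934008⟩ : WeierstrassCurve ℚ).HasCM := fun h ↦
    absurd (X9.j_eq_of_intModel 1 (-1) 0 (-59877) (-3934008) hI ▸ (hasCM_iff_j_mem_holds _).mp h)
      (by decide +kernel)
  have hH : SatisfiesHeegnerHypothesis
      ((⟨1, -1, 0, -59877, -3934008⟩ : WeierstrassCurve ℚ).conductorNorm ℤ) K := by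
    rw [hN]; exact heegner_2601_neg8 K hK.1 hdK
  have hℓ : Zhang2014.IsKolyvaginPrime ((⟨1, -1, 0, -59877, -3934008⟩ : WeierstrassCurve ℚ).conductorNorm ℤ)
      (⟨1, -1, 0, -59877, -3934008⟩ : WeierstrassCurve ℚ) K 3 5 := by
    refine ⟨by norm_num, by rw [hN]; norm_num, by rw [hdK]; norm_num, by norm_num, hinert, ?_⟩
    exact (Zhang2014.le_kolyvaginIndex_iff (M := 1)).mpr
      ⟨by norm_num, by rw [frobeniusTrace_eq hI card_v2601h1_5]; norm_num⟩
  exact card_sha_primary_eq_of_indexCertificate_of_matarNekovar h₁ h₂ hCM hK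
    (by rw [hdK]; norm_num) (by rw [hdK]; norm_num) hH (by decide) (towerSurj3_v2601h1 hI) hr d₁ P
    hP hy hidx hv d hℓ hPℓ

/-- **RECORD `2601h1`: `BSD(E,3)`** from the same certificate, Cremona's `#Ш_an = 9` (`hq`) and GZK
(`hGZK`). (`N = 2601 = 3²·17²`; Cremona's minimal model `[1, -1, 0, -59877, -3934008]`; ADDITIVE
(potentially multiplicative) at `3`; `r_an = 0`, `#Ш_an = 9`, `ρ̄_{E,3}` onto — sha-2 V12-CLOSED row;
S0-KD-3 batch 1, Heegner field `K = ℚ(√−8)`; certificate of record: `ℓ = 5`, `P₅ ∉ 3·E(K[5])` — T1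
exact + T2 witness `v = 59`; E1 v0.4.1 j123905 (+ j123743, product cross-check j124104), 2 400 digits;
index half `ord₃ [E(K):ℤy_K] = 1` two-engine (sha-2 koly3; additive-p1 kernel table row `2601h1`);
LABEL SINGLE-ENGINE pre-countersign — EVIDENCE, nothing booked).
[cite: McCallumLMS1991, §1 Theorem (Kolyvagin) (p. 296), Thm. 5.4 (p. 308)]
[cite: MatarNekovar2019, Thm. 0.7 and §0.11 (pp. 456–457)] [cite: Miller2011LMS, §1 and Def. 1.1] -/
theorem bsdp3_v2601h1
    (h₁ : McCallum1991_card_sha_primary_of_derivedPoint_not_divisible)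
    (h₂ : MatarNekovar2019_card_sha_primary_baseChange_of_derivedPoint_not_divisible_of_irreducible)
    (hGZK : rank_eq_analyticRank_of_analyticRank_le_one)
    (W : WeierstrassCurve ℚ) (hW : W = ⟨1, -1, 0, -59877, -3934008⟩) [NeZero (W.conductorNorm ℤ)]
    (hN : W.conductorNorm ℤ = 2601) (hr : W.analyticRank = 0) (hq : shaAn W = ((9 : ℚ) : ℂ))
    {K : Type} [Field K] [NumberField K] (hK : IsImaginaryQuadratic K)
    (hdK : NumberField.discr K = -8) (hinert : (Ideal.span {((5 : ℕ) : 𝓞 K)}).IsPrime)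
    {Dt : ModularParametrizationData W (W.conductorNorm ℤ)} {β : ℤ} {ι : K →+* ℂ}
    (d₁ : KolyvaginHeegnerData Dt β ι 1) (P : (W.baseChange K).toAffine.Point)
    (hP : d₁.toGeomPoints d₁.derivedPoint = WeierstrassCurve.toGeomPoints (W.baseChange K) P)
    (hy : ¬ IsOfFinAddOrder P) (hidx : (AddSubgroup.zmultiples P).index ≠ 0)
    (hv : padicValNat 3 (AddSubgroup.zmultiples P).index = 1)
    (d : KolyvaginHeegnerData Dt β ι 5)
    (hPℓ : ¬ ∃ Q : (W.baseChange (ringClassField K ι 5)).toAffine.Point,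
      ((3 : ℕ) : ℤ) • Q = d.derivedPoint) :
    haveI : Fact (Nat.Prime 3) := ⟨Nat.prime_three⟩
    BSDp W 3 := by
  haveI : Fact (Nat.Prime 3) := ⟨Nat.prime_three⟩
  subst hW
  haveI hE : (⟨1, -1, 0, -59877, -3934008⟩ : WeierstrassCurve ℚ).IsElliptic :=
    X11b.isElliptic_of_discOf_ne_zero 1 (-1) 0 (-59877) (-3934008) (by decide +kernel)
  haveI hM : (⟨1, -1, 0, -59877, -3934008⟩ : WeierstrassCurve ℚ).IsGloballyMinimal :=
    isGloballyMinimal_of_krausCriterion_bounded 1 (-1) 0 (-59877) (-3934008)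
      (by decide +kernel) (by decide +kernel) (by decide +kernel)
  have hI : integralModelInt (⟨1, -1, 0, -59877, -3934008⟩ : WeierstrassCurve ℚ) =
      (⟨1, -1, 0, -59877, -3934008⟩ : WeierstrassCurve ℤ) :=
    integralModelInt_eq_of_map_eq _ (map_mk_int 1 (-1) 0 (-59877) (-3934008))
  have hCM : ¬ (⟨1, -1, 0, -59877, -3934008⟩ : WeierstrassCurve ℚ).HasCM := fun h ↦
    absurd (X9.j_eq_of_intModel 1 (-1) 0 (-59877) (-3934008) hI ▸ (hasCM_iff_j_mem_holds _).mp h)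
      (by decide +kernel)
  have hH : SatisfiesHeegnerHypothesis
      ((⟨1, -1, 0, -59877, -3934008⟩ : WeierstrassCurve ℚ).conductorNorm ℤ) K := by
    rw [hN]; exact heegner_2601_neg8 K hK.1 hdK
  have hℓ : Zhang2014.IsKolyvaginPrime ((⟨1, -1, 0, -59877, -3934008⟩ : WeierstrassCurve ℚ).conductorNorm ℤ)
      (⟨1, -1, 0, -59877, -3934008⟩ : WeierstrassCurve ℚ) K 3 5 := by
    refine ⟨by norm_num, by rw [hN]; norm_num, by rw [hdK]; norm_num, by norm_num, hinert, ?_⟩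
    exact (Zhang2014.le_kolyvaginIndex_iff (M := 1)).mpr
      ⟨by norm_num, by rw [frobeniusTrace_eq hI card_v2601h1_5]; norm_num⟩
  have h9 : padicValNat 3 9 = 2 := by simpa using padicValNat.prime_pow (p := 3) 2
  have hvq : padicValRat 3 (9 : ℚ) = ((2 * 1 : ℕ) : ℤ) := by
    rw [show (9 : ℚ) = ((9 : ℕ) : ℚ) by norm_num, padicValRat.of_nat, h9]
  exact bsdp_of_indexCertificate_of_matarNekovar h₁ h₂ hGZK hCM hK
    (by rw [hdK]; norm_num) (by rw [hdK]; norm_num) hH (by decide) (towerSurj3_v2601h1 hI) hr d₁ P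
    hP hy hidx hv d hℓ hPℓ hq hvq

end Summit.BirchSwinnertonDyer.Rank1Residual.Additive.X4KolyvaginRecords

end
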